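import Summits.QuantumFields.BalabanUV.T4Continuum.Support.ShellMeasureCommutatorCovDatum
import Summits.QuantumFields.BalabanUV.T4Continuum.Support.ShellMeasureCommutatorGradientLocal

/-!
# `T4Continuum.ShellMeasureCommutatorLevels` — row S65 f5 (junction J2, part c): THE `∇`-PART OF (98) AT THE LIVE
# LEVELS — leaf-05's LOCALISED commutator-gradient bound read in the (Ω_j)-WEIGHTED norms as `Prop4Hyp` from the source
# space `max{|·|_{(−1)}, |∇·|_{(−2)}}`, with a VOLUME-FREE, k-UNIFORM constant `144(d−1)·‖w‖·‖τ‖·Lc³`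
# (cell `pub-balaban`, sub-cell `t4`, spine estimate NE7c (node U5b), crew lineage `b2b-balaban-t4-ne7c-formalise-leaf-02`
# gen 8, owner table `LEAVES-NE7c-P1.md` row S65; imports this lineage's f5b `ShellMeasureCommutatorCovDatum` and
# leaf-05-g7's S65 f3d `ShellMeasureCommutatorGradientLocal` (p222918) ONLY; [folklore]; 0 sorry)

HONEST FRAMING.  Finite four-torus programme, rung (B)+1 only — NOT infinite volume, NOT a mass gap, NOT the Clay
problem, NOT summit progress; (B), `BetaPertHyp`, (B^μ) are not consumed.  NE7c (`T4IndicatorShell.ShellWeightBound`)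
is NOT PRINTED and NOT PROVED; «NE7c ⇐ the named binders» (WALL `t4/b2b-balaban-t4-ne7c-p1/WALL-NE7c-P1.md` §2).
ELEMENTARY bookkeeping ([folklore]); [Balaban1985Variational] (39)∕(91)–(98) are LOCATORS for the shape only — the paper
is under adjudication; nothing printed is asserted or cited as a fact; no `def` and no `def … : Prop` is minted.
HONEST DEPENDENCY (cell): continuum YM on T⁴ ⇐ BetaPertH ∧ nine spine estimates (0/9 proved); BetaPertH ⇐ (D1) ∧ (D4)
∧ CAP+tail; G-an2-4 gates asym, D1 and NE2/3/4.

THE POINT (locator `HOME/b2b-balaban-t4-ne7c-formalise-leaf-02/XREAD-P4-B11-SectB.md` §3 (j)–(k)).  The `∇`-part of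
(98) is where the multi-scale GAIN lives: the naive bound loses `Lʲ` on `Ω_j`, print's repair is (93) + [6] (1.52).
leaf-05-g7's S65 f3 types the repaired bound at one grid with the two scales as plain sups, and — on the holder's request
(NOTE l.15673) — f3d `norm_sum_dcub_bump_le_local` reads the sups ONLY NEAR THE BOND: `‖B x μ‖ ≤ a` for
`x ∈ nbhdSites y κ`, `‖(D^η_{U₀,κ′}B_τ)(x)‖ ≤ G` for `x ∈ baseSites y`, conclusion
`|Σ_p dcub(B)[ι_bX](p)| ≤ 144(d−1)·|w|·‖τ‖·a·G·‖X‖`.  Locality is exactly what lets the weights of f2a∕f2c enter bond by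
bond, as in f2b for the `∇`-free part.  THIS FILE (one theorem + its flat form):
* `norm_locGrad_cubT_le_local`: for a bond `b = ⟨y, y+e_κ⟩` of `Λ` with LOCAL FLOORS `Wf b` (`≤` the weight of every
  `Λ`-bond at a site of `nbhdSites y κ`) and `Wd b` (the `∇`-datum `Dv`, read in `WSup wd 2`, dominates
  `(Wd b)²·‖(D^η_{U₀}(ext A))(x)‖` for `x ∈ baseSites y` — the abstract form of «the weight of the derivative pairs near
  b»), `‖locGrad (cubT …) A b‖ ≤ 144(d−1)·‖w‖·‖τ‖·(‖A‖_{(−1)}∕Wf b)·(‖Dv A‖_{(−2)}∕(Wd b)²)`;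
* **`prop4Hyp_locGrad_cubT_levels`**: if moreover the bond's own weight is within the scale jump of its floors,
  `wt b ≤ Lc·Wf b`, `wt b ≤ Lc·Wd b` (`1 ≤ Lc`; for Bałaban `Lc = L`: neighbouring bonds differ by at most one scale),
  then from f2c's `WMax wt wd Dv` (= `max{|A|_{(−1)}, |∇A|_{(−2)}}`) to `WSup wt 3 (𝔸 →L[ℂ] ℂ)` (= `|·|_{(−3)}`):
  `Prop4Hyp (Y ↦ locGrad (cubT …) Y) (144(d−1)·‖w‖·‖τ‖·Lc³) a₃` for EVERY `a₃` — the (97)∕(98) SHAPE of the `∇`-part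
  with `C₄^∇ = 144(d−1)·‖w‖·‖τ‖·Lc³` INDEPENDENT of `#Pl`, `#Λ` and of the number of scales; by f2c `Prop4Hyp.add` it sums
  with the `∇`-free part (`prop4Hyp_locGrad_levels_max`) to ONE `hW`-shaped statement.
NOT HERE: the identification of `cubT` ∕ of the `∇`-datum with Bałaban's sectioned objects and weights `w(b) = L^{j(b)}η`
(node O ∕ the [dict]; S63 (a)'s η-currency), the cubic binder of the `∇`-free part for the actual action (S65 f4, leaf-03),
the HD-dressing (S66).  So the `∇`-part of ONE W-a binder is KERNEL at the live levels in our typing, under displayed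
geometric hypotheses; no estimate of Bałaban's is discharged.
-/

noncomputable section

open scoped BigOperators

namespace Summit.QuantumFields.BalabanUV.T4Continuum.ShellMeasureCommutatorLevels

open Literature.MathematicalPhysics.QuantumFieldTheory.Balaban1983to89
open B7Prop1Explicit (e U1)
open B8Ineq132 (covDerivFwd)
open B11Prop6Scheme (Prop4Hyp)
open Summit.QuantumFields.BalabanUV.T4Continuum.ShellMeasureCommutatorVariation (bump cub dcub plaqStar)
open Summit.QuantumFields.BalabanUV.T4Continuum.ShellMeasureCommutatorGradientLocal
  (baseSites nbhdSites norm_sum_dcub_bump_le_local)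
open Summit.QuantumFields.BalabanUV.T4Continuum.ShellMeasureCommutatorLocGrad (ext ext_apply_of_mem ext_apply_of_not_mem cubT)
open Summit.QuantumFields.BalabanUV.T4Continuum.ShellMeasureCommutatorCovDatum (differentiable_locGrad_cubT)
open Summit.QuantumFields.BalabanUV.T4Continuum.ShellMeasureLocalGradientTail (locGrad)
open Summit.QuantumFields.BalabanUV.T4Continuum.ShellMeasureMultiGridNorms
open Summit.QuantumFields.BalabanUV.T4Continuum.ShellMeasureMultiGridNormsMax

export B7Prop1Explicit (Site)

variable {d : ℕ} {𝔸 : Type*} [NormedRing 𝔸] [NormOneClass 𝔸] [NormedAlgebra ℂ 𝔸]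
variable (Λ : Finset (Site d × Fin d)) (Pl : Finset (Fin d × Fin d × Site d)) (w : ℂ) {τ : 𝔸 →L[ℂ] ℂ}
  (wt : ↥Λ → ℝ) [hwt : Fact (∀ b, 0 < wt b)] {I : Type*} [Fintype I] (wd : I → ℝ) [hwd : Fact (∀ i, 0 < wd i)]
  (Dv : (↥Λ → 𝔸) →L[ℂ] (I → 𝔸)) (Wf Wd : ↥Λ → ℝ)

/-! ## §1 The weight arithmetic (pure reals) -/

omit [NormOneClass 𝔸] in
/-- `wt³·g ≤ K·Lc³·M²` from `g ≤ K·(N₁∕Wf)·(N₂∕Wd²)`, `N₁, N₂ ≤ M`, `wt ≤ Lc·Wf`, `wt ≤ Lc·Wd`. [folklore] -/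
theorem weight_arith {K wb Wfb Wdb Lc N₁ N₂ M g : ℝ} (hK : 0 ≤ K) (hwb : 0 ≤ wb) (hWf : 0 < Wfb) (hWd : 0 < Wdb)
    (hLc : 0 ≤ Lc) (hcf : wb ≤ Lc * Wfb) (hcd : wb ≤ Lc * Wdb) (hN₁ : 0 ≤ N₁) (hN₂ : 0 ≤ N₂) (h1 : N₁ ≤ M)
    (h2 : N₂ ≤ M) (hg : g ≤ K * (N₁ / Wfb) * (N₂ / Wdb ^ 2)) : wb ^ 3 * g ≤ K * Lc ^ 3 * M ^ 2 := by
  have hq1 : wb / Wfb ≤ Lc := (div_le_iff₀ hWf).2 hcf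
  have hq2 : wb / Wdb ≤ Lc := (div_le_iff₀ hWd).2 hcd
  have hq0 : 0 ≤ wb / Wdb := div_nonneg hwb hWd.le
  have hr : (wb / Wfb) * (wb / Wdb) ^ 2 ≤ Lc ^ 3 := by
    calc (wb / Wfb) * (wb / Wdb) ^ 2 ≤ Lc * Lc ^ 2 :=
        mul_le_mul hq1 (pow_le_pow_left₀ hq0 hq2 2) (sq_nonneg _) hLc
      _ = Lc ^ 3 := by ring
  have hNN : N₁ * N₂ ≤ M * M := mul_le_mul h1 h2 hN₂ ((hN₁.trans h1))
  have he : wb ^ 3 * (K * (N₁ / Wfb) * (N₂ / Wdb ^ 2)) = K * ((wb / Wfb) * (wb / Wdb) ^ 2) * (N₁ * N₂) := by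
    field_simp
  calc wb ^ 3 * g ≤ wb ^ 3 * (K * (N₁ / Wfb) * (N₂ / Wdb ^ 2)) := mul_le_mul_of_nonneg_left hg (pow_nonneg hwb 3)
    _ = K * ((wb / Wfb) * (wb / Wdb) ^ 2) * (N₁ * N₂) := he
    _ ≤ K * Lc ^ 3 * (N₁ * N₂) := mul_le_mul_of_nonneg_right (mul_le_mul_of_nonneg_left hr hK) (mul_nonneg hN₁ hN₂)
    _ ≤ K * Lc ^ 3 * (M * M) := mul_le_mul_of_nonneg_left hNN (mul_nonneg hK (pow_nonneg hLc 3))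
    _ = K * Lc ^ 3 * M ^ 2 := by ring

/-! ## §2 The localised bound, weight-ready -/

omit [NormOneClass 𝔸] in
/-- The LOCAL FIELD SIZE near a bond from the weighted norm: if `Wf b` is below the weight of every `Λ`-bond at a site
of `nbhdSites y κ` (`b = ⟨y, y+e_κ⟩`), then `‖(ext A)(x, μ)‖ ≤ |A|_{(−1)}∕Wf b` there. [folklore] -/
theorem norm_ext_le_local {b : ↥Λ} (hWf0 : 0 < Wf b)
    (hWf : ∀ b' : ↥Λ, b'.1.1 ∈ nbhdSites b.1.1 b.1.2 → Wf b ≤ wt b') (A : ↥Λ → 𝔸)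
    {x : Site d} (hx : x ∈ nbhdSites b.1.1 b.1.2) (μ : Fin d) :
    ‖ext Λ A x μ‖ ≤ ‖(WSup.toPiL wt 1).symm A‖ / Wf b := by
  rw [le_div_iff₀ hWf0]
  by_cases h : (x, μ) ∈ Λ
  · rw [ext_apply_of_mem Λ A h]
    have h1 := WSup.norm_apply_le wt 1 ((WSup.toPiL wt 1).symm A) ⟨(x, μ), h⟩
    rw [pow_one, WSup.toPiL_symm_apply] at h1
    have h2 : Wf b ≤ wt ⟨(x, μ), h⟩ := hWf ⟨(x, μ), h⟩ hx
    calc ‖A ⟨(x, μ), h⟩‖ * Wf b ≤ ‖A ⟨(x, μ), h⟩‖ * wt ⟨(x, μ), h⟩ :=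
        mul_le_mul_of_nonneg_left h2 (norm_nonneg _)
      _ = wt ⟨(x, μ), h⟩ * ‖A ⟨(x, μ), h⟩‖ := mul_comm _ _
      _ ≤ _ := h1
  · rw [ext_apply_of_not_mem Λ A h, norm_zero, zero_mul]
    exact norm_nonneg _

/-- **THE LOCALISED BOUND OF THE `∇`-PART, WEIGHT-READY.**  For a bond `b` of `Λ` whose star lies in the increasing
plaquette set `Pl`, with local floors `Wf b` (field) and `Wd b` (derivative, through the domination hypothesis `hDv`
of the `∇`-datum read in `WSup wd 2`):
`‖locGrad (cubT …) A b‖ ≤ 144(d−1)·‖w‖·‖τ‖·(|A|_{(−1)}∕Wf b)·(|Dv A|_{(−2)}∕(Wd b)²)`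
(leaf-05's f3d `norm_sum_dcub_bump_le_local` + f5a `norm_locGrad_cubT_le`). [folklore] -/
theorem norm_locGrad_cubT_le_local {η : ℝ} (hη : 0 < η) {U₀ : Site d → Fin d → 𝔸ˣ} (h₀ : ∀ y κ, U₀ y κ ∈ U1 𝔸)
    (htr : ∀ P Q : 𝔸, τ (P * Q) = τ (Q * P)) (hincr : ∀ p ∈ Pl, p.1 < p.2.1)
    {b : ↥Λ} (hst : plaqStar b.1.1 b.1.2 ⊆ Pl) (hWf0 : 0 < Wf b) (hWd0 : 0 < Wd b)
    (hWf : ∀ b' : ↥Λ, b'.1.1 ∈ nbhdSites b.1.1 b.1.2 → Wf b ≤ wt b')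
    (hDv : ∀ (A : ↥Λ → 𝔸) (x : Site d) (κ' τ' : Fin d), x ∈ baseSites b.1.1 →
      Wd b ^ 2 * ‖covDerivFwd η U₀ κ' (fun z => ext Λ A z τ') x‖ ≤ ‖(WSup.toPiL wd 2).symm (Dv A)‖)
    (A : ↥Λ → 𝔸) :
    ‖locGrad (cubT Λ Pl w τ η U₀) A b‖ ≤ 144 * ((d : ℝ) - 1) * ‖w‖ * ‖τ‖ *
      (‖(WSup.toPiL wt 1).symm A‖ / Wf b) * (‖(WSup.toPiL wd 2).symm (Dv A)‖ / Wd b ^ 2) := by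
  have hd : 0 ≤ (d : ℝ) - 1 := by
    have : 1 ≤ d := Nat.succ_le_of_lt (Fin.pos b.1.2)
    have : (1 : ℝ) ≤ d := by exact_mod_cast this
    linarith
  have hB : ∀ (x : Site d) (μ : Fin d), x ∈ nbhdSites b.1.1 b.1.2 →
      ‖ext Λ A x μ‖ ≤ ‖(WSup.toPiL wt 1).symm A‖ / Wf b := fun x μ hx =>
    norm_ext_le_local Λ wt Wf hWf0 hWf A hx μ
  have hG : ∀ (x : Site d) (κ' τ' : Fin d), x ∈ baseSites b.1.1 →
      ‖covDerivFwd η U₀ κ' (fun z => ext Λ A z τ') x‖ ≤ ‖(WSup.toPiL wd 2).symm (Dv A)‖ / Wd b ^ 2 := by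
    intro x κ' τ' hx
    rw [le_div_iff₀ (pow_pos hWd0 2), mul_comm]
    exact hDv A x κ' τ' hx
  refine ShellMeasureCommutatorLocGrad.norm_locGrad_cubT_le Λ Pl w τ η U₀ A b (by positivity) fun X => ?_
  have h := norm_sum_dcub_bump_le_local hη h₀ hB hG w htr hst hincr X
  calc _ ≤ 144 * ((d : ℝ) - 1) * ‖w‖ * ‖τ‖ * (‖(WSup.toPiL wt 1).symm A‖ / Wf b) *
        (‖(WSup.toPiL wd 2).symm (Dv A)‖ / Wd b ^ 2) * ‖X‖ := h
    _ = _ := by ring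

/-! ## §3 The `∇`-part of (98) at the live levels as `Prop4Hyp` -/

/-- **THE `∇`-PART OF (98) AT THE LIVE LEVELS, AS `Prop4Hyp`.**  Data: positive bond weights `wt` (Bałaban: `L^{j(b)}η`),
derivative-index weights `wd`, a `∇`-datum `Dv`; per bond `b` of `Λ` local floors `Wf b`, `Wd b` as in
`norm_locGrad_cubT_le_local`, with the bond's own weight within the scale jump of its floors: `wt b ≤ Lc·Wf b`,
`wt b ≤ Lc·Wd b`, `1 ≤ Lc`; `Pl` increasing plaquettes containing every star; `U₀` `U1`-valued; `τ` tracial.  Then from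
f2c's source space `WMax wt wd Dv` (`max{|A|_{(−1)}, |∇A|_{(−2)}}`) to `WSup wt 3 (𝔸 →L[ℂ] ℂ)` (`|·|_{(−3)}`):
`Prop4Hyp (Y ↦ locGrad (cubT …) Y) (144(d−1)·‖w‖·‖τ‖·Lc³) a₃` for EVERY `a₃` — [Balaban1985Variational] (97)∕(98) TYPE for
the `∇`-part with `C₄^∇` VOLUME-FREE and k-UNIFORM (nothing printed is asserted). [folklore] -/
theorem prop4Hyp_locGrad_cubT_levels {η : ℝ} (hη : 0 < η) {U₀ : Site d → Fin d → 𝔸ˣ} (h₀ : ∀ y κ, U₀ y κ ∈ U1 𝔸)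
    (htr : ∀ P Q : 𝔸, τ (P * Q) = τ (Q * P)) (hincr : ∀ p ∈ Pl, p.1 < p.2.1)
    (hst : ∀ b : ↥Λ, plaqStar b.1.1 b.1.2 ⊆ Pl) {Lc : ℝ} (hLc : 1 ≤ Lc)
    (hWf0 : ∀ b, 0 < Wf b) (hWd0 : ∀ b, 0 < Wd b)
    (hWf : ∀ b b' : ↥Λ, b'.1.1 ∈ nbhdSites b.1.1 b.1.2 → Wf b ≤ wt b')
    (hcf : ∀ b, wt b ≤ Lc * Wf b) (hcd : ∀ b, wt b ≤ Lc * Wd b)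
    (hDv : ∀ (A : ↥Λ → 𝔸) (b : ↥Λ) (x : Site d) (κ' τ' : Fin d), x ∈ baseSites b.1.1 →
      Wd b ^ 2 * ‖covDerivFwd η U₀ κ' (fun z => ext Λ A z τ') x‖ ≤ ‖(WSup.toPiL wd 2).symm (Dv A)‖)
    (a₃ : ℝ) :
    Prop4Hyp (fun Y : WMax wt wd Dv =>
        (WSup.toPiL wt 3).symm (locGrad (cubT Λ Pl w τ η U₀) (WMax.toPiL wt wd Dv Y)))
      (144 * ((d : ℝ) - 1) * ‖w‖ * ‖τ‖ * Lc ^ 3) a₃ where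
  quad Y _ := by
    have hLc0 : 0 < Lc := one_pos.trans_le hLc
    have hA1 : ‖(WSup.toPiL wt 1).symm (WMax.toPiL wt wd Dv Y)‖ ≤ ‖Y‖ := WMax.norm_wsup_le wt wd Dv Y
    have hA2 : ‖(WSup.toPiL wd 2).symm (Dv (WMax.toPiL wt wd Dv Y))‖ ≤ ‖Y‖ := WMax.norm_deriv_le wt wd Dv Y
    by_cases hΛ : Nonempty ↥Λ
    · obtain ⟨b₀⟩ := hΛ
      have hd : 0 ≤ (d : ℝ) - 1 := by
        have : 1 ≤ d := Nat.succ_le_of_lt (Fin.pos b₀.1.2)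
        have : (1 : ℝ) ≤ d := by exact_mod_cast this
        linarith
      have hK : 0 ≤ 144 * ((d : ℝ) - 1) * ‖w‖ * ‖τ‖ := by positivity
      have hC : 0 ≤ 144 * ((d : ℝ) - 1) * ‖w‖ * ‖τ‖ * Lc ^ 3 * ‖Y‖ ^ 2 := by positivity
      refine (WSup.norm_le_iff wt 3 hC).2 fun b => ?_
      have hloc := norm_locGrad_cubT_le_local Λ Pl w wt wd Dv Wf Wd hη h₀ htr hincr (hst b) (hWf0 b) (hWd0 b)
        (hWf b) (fun A x κ' τ' hx => hDv A b x κ' τ' hx) (WMax.toPiL wt wd Dv Y)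
      exact weight_arith hK (hwt.out b).le (hWf0 b) (hWd0 b) hLc0.le (hcf b) (hcd b) (norm_nonneg _) (norm_nonneg _)
        hA1 hA2 hloc
    · -- no bonds: `Y = 0`, both sides vanish
      have hY0 : Y = 0 := funext fun b => (hΛ ⟨b⟩).elim
      have hW0 : ‖(WSup.toPiL wt 3).symm (locGrad (cubT Λ Pl w τ η U₀) (WMax.toPiL wt wd Dv Y))‖ ≤ 0 :=
        (WSup.norm_le_iff wt 3 le_rfl).2 fun b => (hΛ ⟨b⟩).elim
      rw [hY0, norm_zero]
      rw [hY0] at hW0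
      simpa using hW0
  differentiableOn := by
    refine Differentiable.differentiableOn ?_
    exact ((WSup.toPiL wt 3).symm.differentiable.comp
      (differentiable_locGrad_cubT Λ η U₀ Pl w τ)).comp (WMax.toPiL wt wd Dv).differentiable

end Summit.QuantumFields.BalabanUV.T4Continuum.ShellMeasureCommutatorLevels

end
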